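import Summits.ResolutionOfSingularities.ResolutionOfSingularities.Theorems.FrobeniusLadderFInjectiveMacaulayficationLx6c3Specimen
import Summits.ResolutionOfSingularities.ResolutionOfSingularities.Theorems.FrobeniusLadderFInjectiveMacaulayficationLoopGermLCharts
import HarnessLib

/-!
# BED T (lx3p3, the first `p = 3` bed): `X = Spec k[x,y,u,t,z]/(z² + x⁴z + y⁴ + u⁴ + t⁵)`, `char k = 3` — PRIME, no variable a multiple, an ISOLATED singularity at the origin
# (crux `FInjectiveMacaulayfication` stmt-ResolutionOfSingularities-15315, chain w45a; res-L1-w45a-plan-1 RULINGS R21.8 (2) / R21.10 (2) «BED T: ★ `f4pos_p3_rowT` = the first p = 3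
# two-sided row, cure half by ONE application of the class theorem `fHalfRow_of_newtonNondegenerate'`»; seat res-L1-w45a-stub-1 g12; letters = res-L1-w45a-stub-2's anticipatory fan
# module `…Lx3p3PointKChar3Fan` (`f = X 4 ^ 2 + X 0 ^ 4 * X 4 + X 1 ^ 4 + X 2 ^ 4 + X 3 ^ 5`, cert 9e1742bf7fecb8ad); template = res-L1-w45a-stub-3's ✓ p646544 `…Lx6c3Specimen`)

[OURS · L1 W4.5a] Support file (`--supports stmt-ResolutionOfSingularities-15315 --as helper`); def-free; UNCONDITIONAL; no named fact; NOT a statement of any manuscript.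
AI-written (AI review is weaker than expert review).

`X 0 = x`, `X 1 = y`, `X 2 = u`, `X 3 = t`, `X 4 = z`; `f = z² + x⁴z + y⁴ + u⁴ + t⁵`; characteristic `3` (`∂_x f = x³z`, `∂_y f = y³`, `∂_u f = u³`, `∂_t f = 2t⁴`, `∂_z f = 2z + x⁴`).
* §1 `pderiv_f` (the five partials), `constantCoeff_f`, ★ `prime_f` (ANY field of characteristic `3`: monic quadric in `z`, Eisenstein-type at `(x,y,u,t) = (0,1,0,−1)` via
  res-L1-w45a-stub-3's `LoopGermLCharts.prime_of_quadric`, `∂_y (y⁴+u⁴+t⁵) = 4 = 1 ≠ 0`), `f_not_mem_span_X` / `mk_X_ne_zero` (no variable is a multiple of `f`: the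
  `hXne` binder of the class row);
* §2 ★ `regular_off_vertex` — `(k[X]/(f))_P` is REGULAR at every prime `P ⊉ 𝔪` (Jacobian criterion `HypersurfaceRegular.stub_hypersurfaceRegularOfPderiv`: off the origin one of
  `y³, u³, 2t⁴, x³z, 2z + x⁴` survives) = the `hreg` binder of `fHalfRow_of_newtonNondegenerate'` (LOCALIZATION form); `regular_of_ne_vertex` (regular-locus form, the
  `hreg` of `PointFloorLegalOfIsolated.pointFloor_input_legal`), `isClosed_vertex`, ★ `vertex_not_mem_regularLocus` (`f ∈ 𝔪²`: the origin IS singular — `hsing`),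
  `isIntegral_lx3p3`.
Not here: Newton non-degeneracy of `f` (`…Lx3p3Newton`), the point-floor charts / input legality (generic ✓ p651649 / p652060), the cover data (stub-2's fan).
[cite: Hartshorne1977, I Thm. 5.1] [cite: Matsumura1987, Thm. 30.4]
-/

-- single-problem summit: the doubled namespace component is forced
set_option linter.dupNamespace false

noncomputable section

open AlgebraicGeometry CategoryTheory Literature.AlgebraicGeometry.Resolution TopologicalSpace IsLocalRing MvPolynomial

namespace Summit.ResolutionOfSingularities.ResolutionOfSingularities.Theorems.FInjectiveMacaulayfication.Lx3p3Specimen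

open Summit.ResolutionOfSingularities.ResolutionOfSingularities.Theorems.FInjectiveMacaulayfication
open GermOfGlobalBlowup

variable (k : Type) [Field k]

/-! ## §1 Partials, primality, no variable is a multiple -/

/-- `(4 : k) = 1` and `(5 : k) = 2` in characteristic `3`. [plumbing] -/
theorem four_eq_one [CharP k 3] : (4 : k) = 1 ∧ (5 : k) = 2 := by
  have h3 : (3 : k) = 0 := by exact_mod_cast CharP.cast_eq_zero k 3
  constructor <;> linear_combination h3

/-- The five partial derivatives of `f` in characteristic `3`: `∂_x f = x³z`, `∂_y f = y³`, `∂_u f = u³`, `∂_t f = 2t⁴`, `∂_z f = 2z + x⁴`. [certificate] -/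
theorem pderiv_f [CharP k 3] (f : MvPolynomial (Fin 5) k) (hf : f = X 4 ^ 2 + X 0 ^ 4 * X 4 + X 1 ^ 4 + X 2 ^ 4 + X 3 ^ 5) :
    pderiv 0 f = X 0 ^ 3 * X 4 ∧ pderiv 1 f = X 1 ^ 3 ∧ pderiv 2 f = X 2 ^ 3 ∧ pderiv 3 f = 2 * X 3 ^ 4 ∧ pderiv 4 f = 2 * X 4 + X 0 ^ 4 := by
  obtain ⟨h4, h5⟩ := four_eq_one k
  have h4' : (4 : MvPolynomial (Fin 5) k) = 1 := by
    rw [← map_ofNat (C : k →+* MvPolynomial (Fin 5) k) 4, h4, map_one]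
  have h5' : (5 : MvPolynomial (Fin 5) k) = 2 := by
    rw [← map_ofNat (C : k →+* MvPolynomial (Fin 5) k) 5, h5, ← map_ofNat (C : k →+* MvPolynomial (Fin 5) k) 2]
  subst hf
  refine ⟨?_, ?_, ?_, ?_, ?_⟩ <;>
  · simp only [map_add, Derivation.leibniz, Derivation.leibniz_pow, pderiv_X_self, pderiv_X_of_ne (show (4 : Fin 5) ≠ 0 by decide),
      pderiv_X_of_ne (show (0 : Fin 5) ≠ 4 by decide), pderiv_X_of_ne (show (1 : Fin 5) ≠ 0 by decide), pderiv_X_of_ne (show (0 : Fin 5) ≠ 1 by decide),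
      pderiv_X_of_ne (show (2 : Fin 5) ≠ 0 by decide), pderiv_X_of_ne (show (0 : Fin 5) ≠ 2 by decide), pderiv_X_of_ne (show (3 : Fin 5) ≠ 0 by decide),
      pderiv_X_of_ne (show (0 : Fin 5) ≠ 3 by decide), pderiv_X_of_ne (show (4 : Fin 5) ≠ 1 by decide), pderiv_X_of_ne (show (1 : Fin 5) ≠ 4 by decide),
      pderiv_X_of_ne (show (4 : Fin 5) ≠ 2 by decide), pderiv_X_of_ne (show (2 : Fin 5) ≠ 4 by decide), pderiv_X_of_ne (show (4 : Fin 5) ≠ 3 by decide),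
      pderiv_X_of_ne (show (3 : Fin 5) ≠ 4 by decide), pderiv_X_of_ne (show (1 : Fin 5) ≠ 2 by decide), pderiv_X_of_ne (show (2 : Fin 5) ≠ 1 by decide),
      pderiv_X_of_ne (show (1 : Fin 5) ≠ 3 by decide), pderiv_X_of_ne (show (3 : Fin 5) ≠ 1 by decide), pderiv_X_of_ne (show (2 : Fin 5) ≠ 3 by decide),
      pderiv_X_of_ne (show (3 : Fin 5) ≠ 2 by decide), smul_eq_mul, mul_zero, add_zero, zero_add, mul_one, nsmul_eq_mul]
    (try push_cast)
    (try simp only [h4', h5'])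
    (try ring)

/-- `f(0) = 0`. [plumbing] -/
theorem constantCoeff_f (f : MvPolynomial (Fin 5) k) (hf : f = X 4 ^ 2 + X 0 ^ 4 * X 4 + X 1 ^ 4 + X 2 ^ 4 + X 3 ^ 5) : constantCoeff f = 0 := by
  rw [hf]; simp [constantCoeff_X]

/-- ★ **`f` is PRIME** over any field of characteristic `3`: the monic quadric `T² + x⁴·T + (y⁴+u⁴+t⁵)` in `z = T`, Eisenstein-type at `(x,y,u,t) = (0,1,0,−1)` where both lower
coefficients vanish and `∂_y(y⁴+u⁴+t⁵) = 4y³ = 1 ≠ 0` (res-L1-w45a-stub-3's criterion `LoopGermLCharts.prime_of_quadric`). [folklore] -/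
theorem prime_f [CharP k 3] (f : MvPolynomial (Fin 5) k) (hf : f = X 4 ^ 2 + X 0 ^ 4 * X 4 + X 1 ^ 4 + X 2 ^ 4 + X 3 ^ 5) : Prime f := by
  obtain ⟨h4, -⟩ := four_eq_one k
  refine LoopGermLCharts.prime_of_quadric k f (X 0 ^ 4) (X 1 ^ 4 + X 2 ^ 4 + X 3 ^ 5) ?_ ![0, 1, 0, -1] ?_ ?_ 1 ?_
  · rw [hf]; simp only [map_add, map_pow, rename_X, Fin.castSucc_zero]; simp; ring
  · simp
  · norm_num [show (![0, 1, 0, -1] : Fin 4 → k) 2 = 0 from rfl, show (![0, 1, 0, -1] : Fin 4 → k) 3 = -1 from rfl,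
      show (![0, 1, 0, -1] : Fin 4 → k) 1 = 1 from rfl]
  · have e1 : pderiv 1 (X 1 ^ 4 + X 2 ^ 4 + X 3 ^ 5 : MvPolynomial (Fin 4) k) = 4 * X 1 ^ 3 := by
      simp only [map_add, Derivation.leibniz_pow, pderiv_X_self, pderiv_X_of_ne (show (2 : Fin 4) ≠ 1 by decide), pderiv_X_of_ne (show (3 : Fin 4) ≠ 1 by decide),
        smul_eq_mul, mul_zero, add_zero, nsmul_eq_mul, mul_one]
      push_cast; ring
    rw [e1]
    simp [h4]

/-- `(f)` is prime. [folklore] -/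
theorem isPrime_span_f [CharP k 3] (f : MvPolynomial (Fin 5) k) (hf : f = X 4 ^ 2 + X 0 ^ 4 * X 4 + X 1 ^ 4 + X 2 ^ 4 + X 3 ^ 5) : (Ideal.span {f}).IsPrime :=
  (Ideal.span_singleton_prime (prime_f k f hf).ne_zero).mpr (prime_f k f hf)

/-- `f ∉ (X i)` for every variable (`f(e_z) = 1`, `f(0,1,0,0,0) = 1`). [certificate] -/
theorem f_not_mem_span_X (f : MvPolynomial (Fin 5) k) (hf : f = X 4 ^ 2 + X 0 ^ 4 * X 4 + X 1 ^ 4 + X 2 ^ 4 + X 3 ^ 5) (i : Fin 5) :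
    f ∉ Ideal.span {(X i : MvPolynomial (Fin 5) k)} := by
  intro h
  obtain ⟨c, hc⟩ := Ideal.mem_span_singleton.mp h
  by_cases hi : i = 4
  · subst hi
    have := congrArg (MvPolynomial.eval ![(0 : k), 1, 0, 0, 0]) hc
    rw [hf] at this
    simp at this
  · have := congrArg (MvPolynomial.eval (Pi.single 4 1 : Fin 5 → k)) hc
    rw [hf] at this
    simp [hi] at this

/-- No variable vanishes in `k[X]/(f)` — the `hXne` binder of the class row. [folklore] -/
theorem mk_X_ne_zero [CharP k 3] (f : MvPolynomial (Fin 5) k) (hf : f = X 4 ^ 2 + X 0 ^ 4 * X 4 + X 1 ^ 4 + X 2 ^ 4 + X 3 ^ 5) (i : Fin 5) :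
    Ideal.Quotient.mk (Ideal.span {f}) (X i) ≠ 0 := fun h0 =>
  PrimeTransfer.X_not_mem_span_of_isPrime (isPrime_span_f k f hf) (f_not_mem_span_X k f hf i) (Ideal.Quotient.eq_zero_iff_mem.mp h0)

/-! ## §2 The isolated singularity at the origin -/

/-- ★ **`X` IS REGULAR OFF THE ORIGIN** (localization form = the `hreg` binder of `fHalfRow_of_newtonNondegenerate'`): at a prime `P ⊉ 𝔪` one of the partials
`y³, u³, 2t⁴, x³z, 2z + x⁴` lies outside `P`, and the Jacobian criterion applies (`HypersurfaceRegular.stub_hypersurfaceRegularOfPderiv`). [cite: Matsumura1987, Thm. 30.4] -/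
theorem regular_off_vertex [CharP k 3] (f : MvPolynomial (Fin 5) k) (hf : f = X 4 ^ 2 + X 0 ^ 4 * X 4 + X 1 ^ 4 + X 2 ^ 4 + X 3 ^ 5)
    (P : Ideal (MvPolynomial (Fin 5) k ⧸ Ideal.span {f})) [P.IsPrime]
    (hP : ¬ Ideal.span (Set.range fun j : Fin 5 => Ideal.Quotient.mk (Ideal.span {f}) (X j)) ≤ P) :
    IsRegularLocalRing (Localization.AtPrime P) := by
  obtain ⟨h0, h1, h2, h3, h4⟩ := pderiv_f k f hf
  have h2k : (2 : k) ≠ 0 := by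
    intro h
    have h3' : (3 : k) = 0 := by exact_mod_cast CharP.cast_eq_zero k 3
    have : (1 : k) = 0 := by linear_combination h3' - h
    exact one_ne_zero this
  have hP' : (P.comap (Ideal.Quotient.mk (Ideal.span {f}))).IsPrime := Ideal.comap_isPrime _ _
  set P' := P.comap (Ideal.Quotient.mk (Ideal.span {f})) with hP'def
  have hC2 : (C (2 : k) : MvPolynomial (Fin 5) k) ∉ P' := fun h =>
    hP'.ne_top ((Ideal.eq_top_iff_one _).mpr (by
      have := P'.mul_mem_left (C (2 : k)⁻¹) h
      rwa [← map_mul, inv_mul_cancel₀ h2k, C_1] at this))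
  have two_eq : (2 : MvPolynomial (Fin 5) k) = C (2 : k) := (map_ofNat C 2).symm
  -- some variable lies outside `P'`
  have hex : ∃ j : Fin 5, (X j : MvPolynomial (Fin 5) k) ∉ P' := by
    by_contra hall
    push Not at hall
    exact hP (Ideal.span_le.mpr (by rintro _ ⟨j, rfl⟩; exact hall j))
  by_cases hy : (X 1 : MvPolynomial (Fin 5) k) ∈ P'
  · by_cases hu : (X 2 : MvPolynomial (Fin 5) k) ∈ P'
    · by_cases ht : (X 3 : MvPolynomial (Fin 5) k) ∈ P'
      · -- `y, u, t ∈ P'`: then `x ∉ P'` or `z ∉ P'`; use `∂_z f = 2z + x⁴` unless both are outside, then `∂_x f = x³z`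
        by_cases hx : (X 0 : MvPolynomial (Fin 5) k) ∈ P'
        · have hz : (X 4 : MvPolynomial (Fin 5) k) ∉ P' := by
            obtain ⟨j, hj⟩ := hex
            fin_cases j <;> simp_all
          refine HypersurfaceRegular.stub_hypersurfaceRegularOfPderiv k 5 f 4 P ?_
          rw [h4]
          intro hmem
          have : (2 : MvPolynomial (Fin 5) k) * X 4 ∈ P' := by
            have := Ideal.sub_mem _ hmem (Ideal.pow_mem_of_mem P' hx 4 (by norm_num))
            rwa [add_sub_cancel_right] at this
          rw [two_eq] at this
          rcases hP'.mem_or_mem this with h | h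
          · exact hC2 h
          · exact hz h
        · by_cases hz : (X 4 : MvPolynomial (Fin 5) k) ∈ P'
          · refine HypersurfaceRegular.stub_hypersurfaceRegularOfPderiv k 5 f 4 P ?_
            rw [h4]
            intro hmem
            have : (X 0 : MvPolynomial (Fin 5) k) ^ 4 ∈ P' := by
              have := Ideal.sub_mem _ hmem (P'.mul_mem_left 2 hz)
              rwa [add_sub_cancel_left] at this
            exact hx (hP'.mem_of_pow_mem 4 this)
          · refine HypersurfaceRegular.stub_hypersurfaceRegularOfPderiv k 5 f 0 P ?_
            rw [h0]
            intro hmem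
            rcases hP'.mem_or_mem hmem with h | h
            · exact hx (hP'.mem_of_pow_mem 3 h)
            · exact hz h
      · refine HypersurfaceRegular.stub_hypersurfaceRegularOfPderiv k 5 f 3 P ?_
        rw [h3, two_eq]
        intro hmem
        rcases hP'.mem_or_mem hmem with h | h
        · exact hC2 h
        · exact ht (hP'.mem_of_pow_mem 4 h)
    · refine HypersurfaceRegular.stub_hypersurfaceRegularOfPderiv k 5 f 2 P ?_
      rw [h2]
      exact fun hmem => hu (hP'.mem_of_pow_mem 3 hmem)
  · refine HypersurfaceRegular.stub_hypersurfaceRegularOfPderiv k 5 f 1 P ?_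
    rw [h1]
    exact fun hmem => hy (hP'.mem_of_pow_mem 3 hmem)

/-- `X` is integral. [folklore] -/
theorem isIntegral_lx3p3 [CharP k 3] (f : MvPolynomial (Fin 5) k) (hf : f = X 4 ^ 2 + X 0 ^ 4 * X 4 + X 1 ^ 4 + X 2 ^ 4 + X 3 ^ 5) :
    IsIntegral (Spec (.of (MvPolynomial (Fin 5) k ⧸ Ideal.span {f}))) := by
  haveI := isPrime_span_f k f hf
  haveI : IsDomain (MvPolynomial (Fin 5) k ⧸ Ideal.span {f}) := Ideal.Quotient.isDomain _
  infer_instance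

/-- The origin is a closed point. [folklore] -/
theorem isClosed_vertex (f : MvPolynomial (Fin 5) k) (hf : f = X 4 ^ 2 + X 0 ^ 4 * X 4 + X 1 ^ 4 + X 2 ^ 4 + X 3 ^ 5)
    (v : Spec (.of (MvPolynomial (Fin 5) k ⧸ Ideal.span {f})))
    (hv : v.asIdeal = Ideal.span (Set.range fun j : Fin 5 => Ideal.Quotient.mk (Ideal.span {f}) (X j))) :
    IsClosed ({v} : Set (Spec (.of (MvPolynomial (Fin 5) k ⧸ Ideal.span {f})))) :=
  DoublePointFermatCubicGerm.isClosed_origin k f (constantCoeff_f k f hf) v hv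

/-- ★ **THE ORIGIN IS SINGULAR**: `f(0) = 0` and `∇f(0) = 0` (every partial is in `𝔪`) — the `hsing` binder of `PointFloorLegalOfIsolated.pointFloor_input_legal`.
[cite: Hartshorne1977, I Thm. 5.1] -/
theorem vertex_not_mem_regularLocus [CharP k 3] (f : MvPolynomial (Fin 5) k) (hf : f = X 4 ^ 2 + X 0 ^ 4 * X 4 + X 1 ^ 4 + X 2 ^ 4 + X 3 ^ 5)
    (v : Spec (.of (MvPolynomial (Fin 5) k ⧸ Ideal.span {f})))
    (hv : v.asIdeal = Ideal.span (Set.range fun j : Fin 5 => Ideal.Quotient.mk (Ideal.span {f}) (X j))) :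
    v ∉ Scheme.regularLocus (Spec (.of (MvPolynomial (Fin 5) k ⧸ Ideal.span {f}))) := by
  classical
  obtain ⟨h0, h1, h2, h3, h4⟩ := pderiv_f k f hf
  refine not_mem_regularLocus_Spec_of_not_isRegularLocalRing v ?_
  refine not_isRegularLocalRing_localization_of_pderiv_eval_eq_zero (0 : Fin 5 → k) (prime_f k f hf).ne_zero ?_ ?_ v.asIdeal ?_
  · rw [MvPolynomial.eval_zero]
    exact constantCoeff_f k f hf
  · intro i
    by_cases hi0 : i = 0
    · subst hi0; rw [h0]; simp
    by_cases hi1 : i = 1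
    · subst hi1; rw [h1]; simp
    by_cases hi2 : i = 2
    · subst hi2; rw [h2]; simp
    by_cases hi3 : i = 3
    · subst hi3; rw [h3]; simp
    have hi4 : i = 4 := by fin_cases i <;> simp_all
    subst hi4; rw [h4]; simp
  · rw [hv, DoublePointFermatCubicGerm.comap_origin k f (constantCoeff_f k f hf), MvPolynomial.eval_zero, Fedder.span_range_X_eq_ker]

/-- `X` is regular at every point other than the origin (regular-locus form — the `hreg` binder of `PointFloorLegalOfIsolated.pointFloor_input_legal`).
[cite: Hartshorne1977, I Thm. 5.1] -/
theorem regular_of_ne_vertex [CharP k 3] (f : MvPolynomial (Fin 5) k) (hf : f = X 4 ^ 2 + X 0 ^ 4 * X 4 + X 1 ^ 4 + X 2 ^ 4 + X 3 ^ 5)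
    (v : Spec (.of (MvPolynomial (Fin 5) k ⧸ Ideal.span {f})))
    (hv : v.asIdeal = Ideal.span (Set.range fun j : Fin 5 => Ideal.Quotient.mk (Ideal.span {f}) (X j))) :
    ∀ y : Spec (.of (MvPolynomial (Fin 5) k ⧸ Ideal.span {f})), y ⤳ v → y ≠ v →
      y ∈ Scheme.regularLocus (Spec (.of (MvPolynomial (Fin 5) k ⧸ Ideal.span {f}))) := by
  intro y hy hne
  refine FermatCubicConeGerm.mem_regularLocus_Spec_of_isRegularLocalRing y (regular_off_vertex k f hf y.asIdeal fun hle => hne ?_)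
  have h2 : y.asIdeal ≤ v.asIdeal := (PrimeSpectrum.le_iff_specializes y v).mpr hy
  exact PrimeSpectrum.ext (le_antisymm h2 (hv ▸ hle))

/-- ISOLATED, germ form: `Spec 𝒪_{X,v}` is regular off its closed point. [folklore] -/
theorem regular_off_closedPoint_vertex [CharP k 3] (f : MvPolynomial (Fin 5) k) (hf : f = X 4 ^ 2 + X 0 ^ 4 * X 4 + X 1 ^ 4 + X 2 ^ 4 + X 3 ^ 5)
    (v : Spec (.of (MvPolynomial (Fin 5) k ⧸ Ideal.span {f})))
    (hv : v.asIdeal = Ideal.span (Set.range fun j : Fin 5 => Ideal.Quotient.mk (Ideal.span {f}) (X j))) :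
    ∀ s : Spec ((Spec (.of (MvPolynomial (Fin 5) k ⧸ Ideal.span {f}))).presheaf.stalk v),
      s ≠ closedPoint _ → s ∈ Scheme.regularLocus (Spec ((Spec (.of (MvPolynomial (Fin 5) k ⧸ Ideal.span {f}))).presheaf.stalk v)) :=
  regularLocus_Spec_stalk_of_isolated v (regular_of_ne_vertex k f hf v hv)

end Summit.ResolutionOfSingularities.ResolutionOfSingularities.Theorems.FInjectiveMacaulayfication.Lx3p3Specimen

end
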